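import Literature.Probability.RandomPlanarGeometry.HexSAWStripSurfaceBridgeNull
import Literature.Probability.RandomPlanarGeometry.HexSAWStripSurfaceMonotone
import HarnessLib

/-!
# The weighted critical bridges of a strip, squeezed: `β(y)·B_{T+1}(x_c,y) ≤ B_T(x_c,1) ≤ (β(y) + cos(3π/8)x_c B_T(x_c,1))·B_{T+1}(x_c,y)`
# — hence `B_{T+1}(x_c,y) ~ B_T(x_c,1)/β(y)` (`0 < y < y_c`) and `B_{T+1}(x_c,y_c) ≥ 2 y_c` for every `T`

Door «HEX-BY-SQUEEZE» of lane pub-sawmu (a-idea-1 gen 23, Part III of the «YT-RATE» series; lens: bridge decompositions with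
explicit rates).  Beaton–Bousquet-Mélou–de Gier–Duminil-Copin–Guttmann combine the arch cut (20) with the strip identity (18) at
`(T+1, y)` and at `(T, 1)` into (§4.5; arXiv v5 p. 15 prints it at `y = y_c`, the earlier arXiv version for `y < y_{T+1}`)

  «`B_T(x_c,1) − β(y) B_{T+1}(x_c,y) ≤ α x_c B_T(x_c,1) B_{T+1}(x_c,y)`, or equivalently
   `0 ≤ 1/B_{T+1}(x_c,y) ≤ α x_c + (1/B_T(x_c,1))·(y* − y)/(y(y* − 1))`»,

and use it only qualitatively (`T → ∞` forces `y* ≥ y_c`).  The tree's `HexSAWStripSurfaceBridgeNull` (a-p2 g8) proves the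
OTHER one-row inequality `β(y)·B_{T+1}(x_c,y) ≤ B_T(x_c,1)` (identity (16) on `S_{T+1}` minus Lemma 2 on `S_T`) and with it the
printed Remark 1 `B_T(x_c,y) → 0` (`y < y*`) at every rate of `B_T(x_c,1)`.  This file types the printed display ITSELF as a lower
bound and reads the two together:

* `stripBlim_le_sandwich_finite` — the display at finite `L`, every `y > 0`:
  `B_T(x_c,1) ≤ (β(y) + cos(3π/8)·x_c·B_T(x_c,1))·B_{T+1,L}(x_c,y) + cos(π/4)·E_{T+1,L}(x_c,y)`;
* `stripBlim_le_mul_stripByLim_succ` / `stripBlim_div_le_stripByLim_succ` — for `0 < y < y*`: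
  **`B_T(x_c,1)/(β(y) + cos(3π/8)x_c·B_T(x_c,1)) ≤ B_{T+1}(x_c,y)`** (the `E`-term dies by face Y3′);
* ★ `abs_stripBlim_div_stripByLim_succ_sub_betaY_le` — with the tree's upper half:
  **`|B_T(x_c,1)/B_{T+1}(x_c,y) − β(y)| ≤ cos(3π/8)·x_c·B_T(x_c,1) (= ((√2−1)/2)·B_T ≤ 0.21·5(ln T)^{-1/3})`**, so
  `B_T(x_c,1)/B_{T+1}(x_c,y) → β(y)` (`tendsto_stripBlim_div_stripByLim_succ`): asymptotically the surface fugacity enters the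
  critical strip-bridge generating function only through the factor `1/β(y) = √2y/(1+√2−y)` — **`B_{T+1}(x_c,y) ~ B_T(x_c,1)/β(y)`**;
* `stripByLim_succ_ge_harmonic` — Duminil-Copin–Smirnov's harmonic lower bound transported to the weights:
  `B_{T+1}(x_c,y) ≥ m₀/(β(y)·T + cos(3π/8)x_c·m₀)`, `m₀ = min(B_1, x_c/cos(3π/8))` (tree `stripBlim_ge_div`);
* ★ `two_mul_yStar_le_stripByLim_succ_yStar` — AT the critical fugacity (`β(y_c) = 0`), whenever `y_c < y_{T+1}` (strict; in the
  tree as soon as door D «GROWTH-STRICT» lands, hypothesis here): **`B_{T+1}(x_c, y_c) ≥ 1/(cos(3π/8)·x_c) = 2 + 2√2 = 2y_c`**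
  uniformly in `T` — against `B_{T+1}(x_c, y) → 0` for every `y < y_c`: the strip bridge mass JUMPS at the adsorption point.

Constants: `cos_three_pi_div_eight_mul_hexCriticalFugacity : cos(3π/8)·x_c = (√2−1)/2`, `inv_eq_two_mul_yStar : ((√2−1)/2)⁻¹ = 2y*`.
Objects: `B_T(x_c,1) = stripBlim T`, `B_T(x_c,y) = stripByLim T y = ⨆_L B_{T,L}(x_c,y)` (`HexSAWStripSurfaceLimits`), `β = betaY`,
`y* = yStar = 1+√2`, `y_T = stripYT T` (lane definition).  Imports: tree only (`HexSAWStripSurfaceBridgeNull`, `HexSAWStripSurfaceMonotone`) ⇒ CLASS S.  No `sorry`, no new axioms.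

Label (planner's reading, lit-1 to confirm): the lower half is the printed §4.5 display typed as printed (CONSOLIDATION, in-house
strengthening = finite `T`, all `0 < y < y*`); the two-sided squeeze, the asymptotic equivalence with explicit relative error, the
weighted harmonic bound and the constant `2y_c` at criticality are lane corollaries NOT in print.

References: [BBdGDCG14] arXiv:1109.0358v5, §4.5 (p. 15), §4.4 Remark 1 and Theorem 10 (p. 14), Corollary 8 (p. 12);
[DCS12] Duminil-Copin–Smirnov, Ann. Math. 175 (2012), §3 (`B_T ≥ min[B_1, 1/(c_α x_c)]/T`); [GM19] Glazman–Manolescu (tree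
`HexSAWBridgeLogDecay`).
-/

noncomputable section

open Finset Filter Topology

namespace Literature.Probability.RandomPlanarGeometry.SAW.HV

variable {T : ℕ}

/-! ### Constants -/

/-- `cos(3π/8)·x_c = (√2 − 1)/2 (= 0.2071…)` (`cos(3π/8) = sin(π/8) = √(2−√2)/2`, `x_c = 1/√(2+√2)`). [folklore]
[cite: DuminilCopinSmirnov2012, §1 ("x_c := 1/√(2+√2)") and §2 (the weight cos(3π/8))] -/
theorem cos_three_pi_div_eight_mul_hexCriticalFugacity :
    Real.cos (3 * Real.pi / 8) * hexCriticalFugacity = (Real.sqrt 2 - 1) / 2 := by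
  have hc : Real.cos (3 * Real.pi / 8) = Real.sqrt (2 - Real.sqrt 2) / 2 := by
    rw [show (3 * Real.pi / 8 : ℝ) = Real.pi / 2 - Real.pi / 8 by ring, Real.cos_pi_div_two_sub,
      Real.sin_pi_div_eight]
  have hx : 0 < hexCriticalFugacity := hexCriticalFugacity_pos_lt_one.1
  have hs2 : Real.sqrt 2 ^ 2 = 2 := Real.sq_sqrt (by norm_num)
  have hs1 : (1 : ℝ) < Real.sqrt 2 := by
    rw [show (1 : ℝ) = Real.sqrt 1 by simp]; exact Real.sqrt_lt_sqrt (by norm_num) (by norm_num)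
  have hs_le : Real.sqrt 2 ≤ 2 := by nlinarith
  have ha2 : Real.sqrt (2 - Real.sqrt 2) ^ 2 = 2 - Real.sqrt 2 := Real.sq_sqrt (by linarith)
  have ha0 : 0 ≤ Real.sqrt (2 - Real.sqrt 2) := Real.sqrt_nonneg _
  have hxc := hexCriticalFugacity_sq
  have hl0 : 0 ≤ Real.cos (3 * Real.pi / 8) * hexCriticalFugacity := by rw [hc]; positivity
  have hr0 : 0 ≤ (Real.sqrt 2 - 1) / 2 := by linarith
  have hsq : (Real.cos (3 * Real.pi / 8) * hexCriticalFugacity) ^ 2 = ((Real.sqrt 2 - 1) / 2) ^ 2 := by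
    -- both squares times `(2 + √2)` equal `(2 − √2)/4`
    have h2p : (0 : ℝ) < 2 + Real.sqrt 2 := by positivity
    have h1 : (Real.cos (3 * Real.pi / 8) * hexCriticalFugacity) ^ 2 * (2 + Real.sqrt 2) = (2 - Real.sqrt 2) / 4 := by
      rw [hc, mul_pow, div_pow, ha2, mul_assoc, hxc]; ring
    have h2 : ((Real.sqrt 2 - 1) / 2) ^ 2 * (2 + Real.sqrt 2) = (2 - Real.sqrt 2) / 4 := by
      linear_combination (Real.sqrt 2 / 4) * hs2
    exact mul_right_cancel₀ h2p.ne' (h1.trans h2.symm)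
  exact (pow_left_inj₀ hl0 hr0 two_ne_zero).1 hsq

/-- `((√2 − 1)/2)⁻¹ = 2(1 + √2) = 2y*` with `y* = 1 + √2`. [folklore]
[cite: BeatonBousquetMelouDeGierDuminilCopinGuttmann2014, §4.1 (arXiv v5 p. 14: "y* = 1 ∓ √2", dilute sign, and "β(y) = (y*−y)/(y(y*−1)) = (1+√2−y)/(√2 y)"; Theorem 2: y_c = 1 + √2)] -/
theorem inv_eq_two_mul_yStar : ((Real.sqrt 2 - 1) / 2)⁻¹ = 2 * yStar := by
  unfold yStar
  have hs2 : Real.sqrt 2 * Real.sqrt 2 = 2 := Real.mul_self_sqrt (by norm_num)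
  have hs1 : (1 : ℝ) < Real.sqrt 2 := by
    rw [show (1 : ℝ) = Real.sqrt 1 by simp]; exact Real.sqrt_lt_sqrt (by norm_num) (by norm_num)
  refine inv_eq_of_mul_eq_one_right ?_
  linear_combination hs2

/-- `0 < cos(3π/8)·x_c`: both factors are positive, `α = cos(3π/8) = √(2−√2)/2` and `x_c = 1/√(2+√2)`.
[cite: BeatonBousquetMelouDeGierDuminilCopinGuttmann2014, §4.1 (arXiv v5 p. 14: "α = cos(3π/8) = √(2−√2)/2", "x_c⁻¹ = 2cos(π(2±1)/8) = √(2∓√2)" with the dilute sign, and "if all coefficients are positive, so we now consider only the dilute regime")] -/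
theorem cos_three_pi_div_eight_mul_hexCriticalFugacity_pos : 0 < Real.cos (3 * Real.pi / 8) * hexCriticalFugacity :=
  mul_pos cos_three_pi_div_eight_pos hexCriticalFugacity_pos_lt_one.1

/-! ### The §4.5 display as a lower bound on `B_{T+1}(x_c, y)` -/

/-- **The §4.5 display at finite `L`, every `y > 0`** (`T ≥ 1`):
`B_T(x_c,1) ≤ (β(y) + cos(3π/8)·x_c·B_T(x_c,1))·B_{T+1,L}(x_c,y) + cos(π/4)·E_{T+1,L}(x_c,y)` — identity (16) at `(T+1, L, y)`,
the arch cut (20), `A_{T,L}(x_c) ≤ A_T(x_c)` and the limit identity `cos(3π/8) A_T + B_T = 1`.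
[cite: BeatonBousquetMelouDeGierDuminilCopinGuttmann2014, §4.5 eq. (20) and the display after it (arXiv v5 p. 15, printed at y = y_c; general y: earlier arXiv version §4.5) with §4.3 Proposition 9 (18) (p. 14)] -/
theorem stripBlim_le_sandwich_finite (hT : 1 ≤ T) (L : ℕ) {y : ℝ} (hy : 0 < y) :
    stripBlim T ≤ (betaY y + Real.cos (3 * Real.pi / 8) * hexCriticalFugacity * stripBlim T) *
        stripGFy (T + 1) L (IsBetaDart (T + 1)) y +
      Real.cos (Real.pi / 4) * stripGFy (T + 1) L (IsEpsDart L) y := by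
  have hid := stripIdentityY_holds (T + 1) L y (by omega) hy
  have hcut := stripArchCut_holds T L y hT hy
  have hAle := stripA_le_lim DuminilCopinSmirnov2012_lemma2_holds hT L
  have hlim := strip_identity_lim hT
  have hα : 0 < Real.cos (3 * Real.pi / 8) := cos_three_pi_div_eight_pos
  have h5 := mul_le_mul_of_nonneg_left hcut hα.le
  have h6 := mul_le_mul_of_nonneg_left hAle hα.le
  have key : stripBlim T ≤ betaY y * stripGFy (T + 1) L (IsBetaDart (T + 1)) y +
      Real.cos (Real.pi / 4) * stripGFy (T + 1) L (IsEpsDart L) y +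
      Real.cos (3 * Real.pi / 8) * (hexCriticalFugacity * stripGFy (T + 1) L (IsBetaDart (T + 1)) y * stripBlim T) := by
    rw [mul_sub] at h5
    linarith
  calc stripBlim T ≤ _ := key
    _ = _ := by ring

/-- **`B_T(x_c,1) ≤ (β(y) + cos(3π/8)·x_c·B_T(x_c,1))·B_{T+1}(x_c,y)`** for `0 < y < y* = 1+√2`, `T ≥ 1` — the `L → ∞` limit
(`B_{T+1,L}(y) → B_{T+1}(y)` and, the bridge class being bounded, `E_{T+1,L}(y) → 0` by face Y3′).
[cite: BeatonBousquetMelouDeGierDuminilCopinGuttmann2014, §4.5 (arXiv v5 p. 15: "B_T(x_c,1) − β(y)B_{T+1}(x_c,y) ≤ α x_c B_T(x_c,1) B_{T+1}(x_c,y)", earlier-version wording; v5 prints it at y = y_c) with Proposition 9 (p. 14)] -/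
theorem stripBlim_le_mul_stripByLim_succ (hT : 1 ≤ T) {y : ℝ} (hy : 0 < y) (hlt : y < 1 + Real.sqrt 2) :
    stripBlim T ≤ (betaY y + Real.cos (3 * Real.pi / 8) * hexCriticalFugacity * stripBlim T) * stripByLim (T + 1) y := by
  have hT1 : 1 ≤ T + 1 := by omega
  have hB := tendsto_stripBy hT1 hy hlt
  have hE := stripELimZeroY_holds (T + 1) y (stripByLim (T + 1) y) hT1 hy (le_stripByLim hT1 hy hlt)
  have hlimit := (hB.const_mul (betaY y + Real.cos (3 * Real.pi / 8) * hexCriticalFugacity * stripBlim T)).add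
    (hE.const_mul (Real.cos (Real.pi / 4)))
  rw [mul_zero, add_zero] at hlimit
  exact ge_of_tendsto hlimit (Filter.Eventually.of_forall fun L => stripBlim_le_sandwich_finite hT L hy)

/-- `0 < β(y)` for `0 < y < y*`. [cite: BeatonBousquetMelouDeGierDuminilCopinGuttmann2014, §4.1 (β = (y*−y)/(y(y*−1)))] -/
theorem betaY_pos_of_lt {y : ℝ} (hy : 0 < y) (hlt : y < 1 + Real.sqrt 2) : 0 < betaY y := by
  rw [betaY]; exact div_pos (by linarith) (by positivity)

/-- `0 < B_{T+1}(x_c, y)` for `0 < y < y*` (from the lower bound, `B_T(x_c,1) > 0`).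
[cite: BeatonBousquetMelouDeGierDuminilCopinGuttmann2014, §4.5 (arXiv v5 p. 15, the display after eq. (20): "0 ≤ 1/B_{T+1}(x_c,y) ≤ α x_c + (1/B_T(x_c,1)) (y*−y)/(y(y*−1))" — B_{T+1}(x_c,y) is finite and non-zero there)] -/
theorem stripByLim_succ_pos (hT : 1 ≤ T) {y : ℝ} (hy : 0 < y) (hlt : y < 1 + Real.sqrt 2) : 0 < stripByLim (T + 1) y := by
  have h := stripBlim_le_mul_stripByLim_succ hT hy hlt
  have hB := stripBlim_pos hT
  have hc : 0 < betaY y + Real.cos (3 * Real.pi / 8) * hexCriticalFugacity * stripBlim T :=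
    add_pos (betaY_pos_of_lt hy hlt) (mul_pos cos_three_pi_div_eight_mul_hexCriticalFugacity_pos hB)
  by_contra hle
  rw [not_lt] at hle
  nlinarith

/-- **Solved form: `B_T(x_c,1)/(β(y) + cos(3π/8)·x_c·B_T(x_c,1)) ≤ B_{T+1}(x_c, y)`** (`0 < y < y*`, `T ≥ 1`).
[cite: BeatonBousquetMelouDeGierDuminilCopinGuttmann2014, §4.5 (arXiv v5 p. 15: "0 ≤ 1/B_{T+1}(x_c,y) ≤ α x_c + (1/B_T(x_c,1))·(y*−y)/(y(y*−1))") with Proposition 9 (p. 14); finite-T form — lane reading] -/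
theorem stripBlim_div_le_stripByLim_succ (hT : 1 ≤ T) {y : ℝ} (hy : 0 < y) (hlt : y < 1 + Real.sqrt 2) :
    stripBlim T / (betaY y + Real.cos (3 * Real.pi / 8) * hexCriticalFugacity * stripBlim T) ≤ stripByLim (T + 1) y := by
  have hc : 0 < betaY y + Real.cos (3 * Real.pi / 8) * hexCriticalFugacity * stripBlim T :=
    add_pos (betaY_pos_of_lt hy hlt) (mul_pos cos_three_pi_div_eight_mul_hexCriticalFugacity_pos (stripBlim_pos hT))
  rw [div_le_iff₀ hc, mul_comm]
  exact stripBlim_le_mul_stripByLim_succ hT hy hlt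

/-! ### The squeeze: `B_T(x_c,1)/B_{T+1}(x_c,y) ∈ [β(y), β(y) + cos(3π/8)·x_c·B_T(x_c,1)]` -/

/-- Upper half of the squeeze, ratio form (the tree's one-row sandwich `β(y) B_{T+1}(y) ≤ B_T`): `β(y) ≤ B_T(x_c,1)/B_{T+1}(x_c,y)`.
[cite: BeatonBousquetMelouDeGierDuminilCopinGuttmann2014, §4.1 eq. (16) (arXiv v5 p. 13) with DuminilCopinSmirnov2012 Lemma 2; tree `betaY_mul_stripByLim_succ_le`] -/
theorem betaY_le_stripBlim_div_stripByLim_succ (hT : 1 ≤ T) {y : ℝ} (hy : 0 < y) (hlt : y < 1 + Real.sqrt 2) :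
    betaY y ≤ stripBlim T / stripByLim (T + 1) y := by
  rw [le_div_iff₀ (stripByLim_succ_pos hT hy hlt)]
  exact betaY_mul_stripByLim_succ_le hT hy hlt

/-- Lower half of the squeeze, ratio form: `B_T(x_c,1)/B_{T+1}(x_c,y) ≤ β(y) + cos(3π/8)·x_c·B_T(x_c,1)`.
[cite: BeatonBousquetMelouDeGierDuminilCopinGuttmann2014, §4.5 (arXiv v5 p. 15) with Proposition 9 (p. 14); lane reading] -/
theorem stripBlim_div_stripByLim_succ_le (hT : 1 ≤ T) {y : ℝ} (hy : 0 < y) (hlt : y < 1 + Real.sqrt 2) :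
    stripBlim T / stripByLim (T + 1) y ≤ betaY y + Real.cos (3 * Real.pi / 8) * hexCriticalFugacity * stripBlim T := by
  rw [div_le_iff₀ (stripByLim_succ_pos hT hy hlt)]
  exact stripBlim_le_mul_stripByLim_succ hT hy hlt

/-- ★ **THE SQUEEZE: `|B_T(x_c,1)/B_{T+1}(x_c,y) − β(y)| ≤ cos(3π/8)·x_c·B_T(x_c,1)`** for `0 < y < y*`, `T ≥ 1` — the surface
fugacity enters the critical strip-bridge generating function, up to a relative error `≤ ((√2−1)/2)·B_T(x_c,1)/β(y) → 0`, only
through the factor `1/β(y) = √2 y/(1+√2−y)`.  [cite: BeatonBousquetMelouDeGierDuminilCopinGuttmann2014, §4.5 (arXiv v5 p. 15) and §4.1 (16) (p. 13) with Theorem 10 (p. 14); two-sided finite-T squeeze — lane corollary, not in print] -/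
theorem abs_stripBlim_div_stripByLim_succ_sub_betaY_le (hT : 1 ≤ T) {y : ℝ} (hy : 0 < y) (hlt : y < 1 + Real.sqrt 2) :
    |stripBlim T / stripByLim (T + 1) y - betaY y| ≤ Real.cos (3 * Real.pi / 8) * hexCriticalFugacity * stripBlim T := by
  rw [abs_le]
  constructor
  · have h := betaY_le_stripBlim_div_stripByLim_succ hT hy hlt
    have h0 : 0 ≤ Real.cos (3 * Real.pi / 8) * hexCriticalFugacity * stripBlim T :=
      (mul_pos cos_three_pi_div_eight_mul_hexCriticalFugacity_pos (stripBlim_pos hT)).le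
    linarith
  · linarith [stripBlim_div_stripByLim_succ_le hT hy hlt]

/-- The same with Glazman–Manolescu's explicit decay: `|B_T(x_c,1)/B_{T+1}(x_c,y) − β(y)| ≤ ((√2−1)/2)·5(ln T)^{-1/3}` (`T ≥ 2`).
[cite: GlazmanManolescu2019, Proposition 1.1 / eq. (3) (tree `hexBridgeLogDecay`); BeatonBousquetMelouDeGierDuminilCopinGuttmann2014, §4.5 (arXiv v5 p. 15); lane composite, not in print] -/
theorem abs_stripBlim_div_stripByLim_succ_sub_betaY_le_log (hT : 2 ≤ T) {y : ℝ} (hy : 0 < y) (hlt : y < 1 + Real.sqrt 2) :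
    |stripBlim T / stripByLim (T + 1) y - betaY y| ≤ (Real.sqrt 2 - 1) / 2 * (5 * Real.log T ^ (-(1 : ℝ) / 3)) := by
  have h := abs_stripBlim_div_stripByLim_succ_sub_betaY_le (T := T) (by omega) hy hlt
  rw [cos_three_pi_div_eight_mul_hexCriticalFugacity] at h
  have h2 : stripBlim T ≤ 5 * Real.log T ^ (-(1 : ℝ) / 3) := hexBridgeLogDecay T hT
  have hc : 0 ≤ (Real.sqrt 2 - 1) / 2 := by
    rw [← cos_three_pi_div_eight_mul_hexCriticalFugacity]; exact cos_three_pi_div_eight_mul_hexCriticalFugacity_pos.le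
  exact h.trans (mul_le_mul_of_nonneg_left h2 hc)

/-- ★ **`B_T(x_c,1)/B_{T+1}(x_c,y) → β(y)`** as `T → ∞`, for every `0 < y < y*`: **`B_{T+1}(x_c,y) ~ B_T(x_c,1)/β(y)`**.
[cite: BeatonBousquetMelouDeGierDuminilCopinGuttmann2014, §4.5 (arXiv v5 p. 15) with Theorem 10 (p. 14: B_T(x_c,1) → 0); asymptotic equivalence — lane corollary, not in print] -/
theorem tendsto_stripBlim_div_stripByLim_succ {y : ℝ} (hy : 0 < y) (hlt : y < 1 + Real.sqrt 2) :
    Tendsto (fun T : ℕ => stripBlim (T + 1) / stripByLim (T + 1 + 1) y) atTop (𝓝 (betaY y)) := by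
  have h0 : Tendsto (fun T : ℕ => Real.cos (3 * Real.pi / 8) * hexCriticalFugacity * stripBlim (T + 1)) atTop (𝓝 0) := by
    have := (tendsto_stripBlim.comp (tendsto_add_atTop_nat 1)).const_mul (Real.cos (3 * Real.pi / 8) * hexCriticalFugacity)
    rw [mul_zero] at this
    exact this
  -- squeeze `|ratio − β| ≤ c·B_{T+1} → 0`
  have hmain : Tendsto (fun T : ℕ => stripBlim (T + 1) / stripByLim (T + 1 + 1) y - betaY y) atTop (𝓝 0) := by
    refine squeeze_zero_norm (fun T => ?_) h0
    rw [Real.norm_eq_abs]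
    exact abs_stripBlim_div_stripByLim_succ_sub_betaY_le (T := T + 1) (by omega) hy hlt
  have := hmain.add_const (betaY y)
  rw [zero_add] at this
  simpa using this

/-! ### Duminil-Copin–Smirnov's harmonic lower bound, with weights -/

/-- **`B_{T+1}(x_c,y) ≥ m₀/(β(y)·T + cos(3π/8)·x_c·m₀)`** for `0 < y < y*`, `T ≥ 1`, `m₀ = min(B_1(x_c,1), x_c/cos(3π/8))`: the tree's
unconditional `B_T(x_c,1) ≥ m₀/T` (`stripBlim_ge_div`) pushed through the increasing map `B ↦ B/(β + cos(3π/8)x_c B)`.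
[cite: DuminilCopinSmirnov2012, §3 (proof of Theorem 1: "B_T ≥ min[B_1, 1/(c_α x_c)]/T"); BeatonBousquetMelouDeGierDuminilCopinGuttmann2014, §4.5 (arXiv v5 p. 15); lane corollary, not in print] -/
theorem stripByLim_succ_ge_harmonic (hT : 1 ≤ T) {y : ℝ} (hy : 0 < y) (hlt : y < 1 + Real.sqrt 2) :
    min (stripBlim 1) (Real.cos (3 * Real.pi / 8) * hexCriticalFugacity⁻¹)⁻¹ /
        (betaY y * T + Real.cos (3 * Real.pi / 8) * hexCriticalFugacity *
          min (stripBlim 1) (Real.cos (3 * Real.pi / 8) * hexCriticalFugacity⁻¹)⁻¹) ≤ stripByLim (T + 1) y := by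
  -- `m₀/T ≤ B_T` (tree, unconditional)
  have hmT : min (stripBlim 1) (Real.cos (3 * Real.pi / 8) * hexCriticalFugacity⁻¹)⁻¹ / (T : ℝ) ≤ stripBlim T := by
    obtain ⟨S, rfl⟩ : ∃ S, T = S + 1 := ⟨T - 1, by omega⟩
    have := stripBlim_ge_div S
    push_cast
    exact this
  set m := min (stripBlim 1) (Real.cos (3 * Real.pi / 8) * hexCriticalFugacity⁻¹)⁻¹ with hm
  set c := Real.cos (3 * Real.pi / 8) * hexCriticalFugacity with hc
  have hmpos : 0 < m := stripBlim_ge_div_pos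
  have hcpos : 0 < c := cos_three_pi_div_eight_mul_hexCriticalFugacity_pos
  have hβ := betaY_pos_of_lt hy hlt
  have hB := stripBlim_pos hT
  have hTpos : (0 : ℝ) < T := by exact_mod_cast hT
  have hmT' : m ≤ stripBlim T * T := (div_le_iff₀ hTpos).1 hmT
  have h1 := stripBlim_div_le_stripByLim_succ hT hy hlt
  -- monotonicity of `B ↦ B/(β + cB)`
  have h2 : m / (betaY y * T + c * m) ≤ stripBlim T / (betaY y + c * stripBlim T) := by
    rw [div_le_div_iff₀ (add_pos (mul_pos hβ hTpos) (mul_pos hcpos hmpos)) (add_pos hβ (mul_pos hcpos hB))]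
    nlinarith [mul_le_mul_of_nonneg_left hmT' hβ.le, mul_pos hcpos (mul_pos hmpos hB)]
  exact h2.trans h1

/-! ### At the critical fugacity: `B_{T+1}(x_c, y_c) ≥ 2 y_c` for every `T` -/

/-- `β(y*) = 0`. [cite: BeatonBousquetMelouDeGierDuminilCopinGuttmann2014, §4.1 (β(y) = (y*−y)/(y(y*−1)))] -/
theorem betaY_yStar : betaY yStar = 0 := by
  unfold betaY yStar; simp

/-- ★ **`B_{T+1}(x_c, y_c) ≥ 1/(cos(3π/8)·x_c) = 2 + 2√2 = 2y_c`, uniformly in `T ≥ 1`**, whenever `y_c = y* < y_{T+1}` strictly (so that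
the critical weighted bridge class of `S_{T+1}` is bounded in `L` and `B_{T+1}(x_c,y_c) = sup_L B_{T+1,L}(x_c,y_c)` is its limit):
the §4.5 display at `y = y_c`, where `β(y_c) = 0` kills the `1/B_T` term — «`0 ≤ 1/B_{T+1}(x_c,y_c) ≤ α x_c + (1/B_T(x_c,1))·(y*−y_c)/(y_c(y*−1))`»
(arXiv v5 p. 15, verbatim) read AFTER Theorem 2 (`y_c = y*`).  Against the tree's `B_{T+1}(x_c,y) → 0` for `y < y_c`
(`tendsto_stripByLim_zero`): the critical strip-bridge mass jumps from `0⁺` to at least `2y_c` at the adsorption point.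
(The strictness hypothesis is BBdGDCG Corollary 8 «y_{T+1} < y_T» with `y* ≤ y_{T+2}`; HOME door D «GROWTH-STRICT» of a-p2 g10.)
[cite: BeatonBousquetMelouDeGierDuminilCopinGuttmann2014, §4.5, the display after (20) at y = y_c (arXiv v5 p. 15) with Theorem 2 (p. 3) and Corollary 8 (p. 12); explicit constant 2y_c — lane corollary, not in print] -/
theorem two_mul_yStar_le_stripByLim_succ_yStar (hT : 1 ≤ T) (h : yStar < stripYT (T + 1)) :
    2 * yStar ≤ stripByLim (T + 1) yStar := by
  have hT1 : 1 ≤ T + 1 := by omega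
  have hy : 0 < yStar := yStar_pos
  -- boundedness of the critical weighted bridge class of `S_{T+1}` (`y* < y_{T+1} = sup` of the bounded set, monotone in `y`)
  have h' : yStar < sSup (stripBddSet (T + 1)) := h
  obtain ⟨y', hy'S, hlt'⟩ := exists_lt_of_lt_csSup (stripBddSet_succ_nonempty T) h'
  obtain ⟨K, hK⟩ := hy'S.2
  have hbdd : BddAbove (Set.range fun L : ℕ => stripGFy (T + 1) L (IsBetaDart (T + 1)) yStar) := by
    refine ⟨K, ?_⟩
    rintro _ ⟨L, rfl⟩
    exact (stripGFy_mono (T + 1) L (IsBetaDart (T + 1)) hy.le hlt'.le).trans (hK ⟨L, rfl⟩)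
  have hB : Tendsto (fun L : ℕ => stripGFy (T + 1) L (IsBetaDart (T + 1)) yStar) atTop (𝓝 (stripByLim (T + 1) yStar)) :=
    tendsto_atTop_ciSup (fun _ _ hL => stripGFy_beta_mono_L hL hy.le) hbdd
  have hle : ∀ L : ℕ, stripGFy (T + 1) L (IsBetaDart (T + 1)) yStar ≤ stripByLim (T + 1) yStar := fun L => le_ciSup hbdd L
  have hE := stripELimZeroY_holds (T + 1) yStar (stripByLim (T + 1) yStar) hT1 hy hle
  have hlimit := (hB.const_mul (betaY yStar + Real.cos (3 * Real.pi / 8) * hexCriticalFugacity * stripBlim T)).add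
    (hE.const_mul (Real.cos (Real.pi / 4)))
  rw [mul_zero, add_zero] at hlimit
  have hmain : stripBlim T ≤ (betaY yStar + Real.cos (3 * Real.pi / 8) * hexCriticalFugacity * stripBlim T) *
      stripByLim (T + 1) yStar :=
    ge_of_tendsto hlimit (Filter.Eventually.of_forall fun L => stripBlim_le_sandwich_finite hT L hy)
  rw [betaY_yStar, zero_add, cos_three_pi_div_eight_mul_hexCriticalFugacity] at hmain
  have hBpos := stripBlim_pos hT
  -- `B_T ≤ ((√2−1)/2) B_T · B_{T+1}(y*)` ⇒ `B_{T+1}(y*) ≥ 2/(√2−1) = 2(1+√2)`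
  have hs2 : Real.sqrt 2 * Real.sqrt 2 = 2 := Real.mul_self_sqrt (by norm_num)
  have hs1 : (1 : ℝ) < Real.sqrt 2 := by
    rw [show (1 : ℝ) = Real.sqrt 1 by simp]; exact Real.sqrt_lt_sqrt (by norm_num) (by norm_num)
  have h1 : 1 ≤ (Real.sqrt 2 - 1) / 2 * stripByLim (T + 1) yStar := by
    by_contra hlt
    rw [not_le] at hlt
    nlinarith
  have hc0 : 0 < (Real.sqrt 2 - 1) / 2 := by linarith
  calc 2 * yStar = ((Real.sqrt 2 - 1) / 2)⁻¹ := inv_eq_two_mul_yStar.symm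
    _ ≤ ((Real.sqrt 2 - 1) / 2)⁻¹ * ((Real.sqrt 2 - 1) / 2 * stripByLim (T + 1) yStar) :=
        le_mul_of_one_le_right (inv_pos.2 hc0).le h1
    _ = stripByLim (T + 1) yStar := by rw [← mul_assoc, inv_mul_cancel₀ hc0.ne', one_mul]

/-- The jump, packaged: if `y* < y_{T+1}` for every `T ≥ 1` (Corollary 8's strictness), then for every `0 < y < y_c` the ratio
`B_{T+1}(x_c,y_c)/B_{T+1}(x_c,y)` tends to `+∞` — indeed `B_{T+1}(x_c,y) ≤ B_T(x_c,1)/β(y) → 0` while `B_{T+1}(x_c,y_c) ≥ 2y_c`.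
Stated as the explicit inequality `B_{T+1}(x_c,y) · 2y_c·β(y) ≤ B_T(x_c,1) · B_{T+1}(x_c,y_c)`.
[cite: BeatonBousquetMelouDeGierDuminilCopinGuttmann2014, §4.4 Remark 1 and §4.5 (arXiv v5 pp. 14–15); lane corollary, not in print] -/
theorem stripByLim_succ_mul_le_of_strict (hT : 1 ≤ T) (h : yStar < stripYT (T + 1)) {y : ℝ} (hy : 0 < y)
    (hlt : y < 1 + Real.sqrt 2) :
    stripByLim (T + 1) y * (2 * yStar * betaY y) ≤ stripBlim T * stripByLim (T + 1) yStar := by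
  have h1 := betaY_mul_stripByLim_succ_le hT hy hlt
  have h2 := two_mul_yStar_le_stripByLim_succ_yStar hT h
  have hβ := betaY_pos_of_lt hy hlt
  have hB0 : 0 ≤ stripByLim (T + 1) y := (stripByLim_succ_pos hT hy hlt).le
  calc stripByLim (T + 1) y * (2 * yStar * betaY y) = (betaY y * stripByLim (T + 1) y) * (2 * yStar) := by ring
    _ ≤ stripBlim T * (2 * yStar) := mul_le_mul_of_nonneg_right h1 (by linarith [yStar_pos])
    _ ≤ stripBlim T * stripByLim (T + 1) yStar := mul_le_mul_of_nonneg_left h2 (stripBlim_pos hT).le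

end Literature.Probability.RandomPlanarGeometry.SAW.HV

end
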